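import Summits.ResolutionOfSingularities.ResolutionOfSingularities.Theorems.EquisingularLiftEquisingularLiftSplit
import Summits.ResolutionOfSingularities.ResolutionOfSingularities.Theorems.EquisingularLiftEquisingularLiftBlowupModelProjectiveResolution
import Literature.AlgebraicGeometry.Resolution.BlowupsProperProofs
import Literature.AlgebraicGeometry.Resolution.ComponentGluing
import HarnessLib

/-!
# Crux `EquisingularLift` (stmt-ResolutionOfSingularities-15660), line `Sketch` (skeleton v10c `f3e6993bf39ec5c9`):
# the DOWNSTAIRS reading — an embedded resolution of `H ⊆ ℙⁿ_k` in the crux's own chain format yields a regular blow-up model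

[OURS · leafhand-res-equisingularlift-6 g1, 2026-08-31] AI-produced, weaker than expert review; NOT a statement of any
manuscript; nothing here proves resolution of singularities in positive characteristic, and NO registered stub is closed.

The crux quantifies a chain of blow-ups of an `O`-ambient in REGULAR centres off the generic point of `Y` (the recursor-encoded
`Split.Chain P Y P' σ S'`, verbatim the fifth conjunct of `EquisingularLift`) with REGULAR reduced last strict transform. The
line's leaves ask instead, hypersurface by hypersurface, for a regular blow-up model of `H` (a PROJECTIVE resolution,
`blowupModel_iff_projectiveResolution`, p816118). This file proves the bridge between the two currencies over a FIELD:

* `exists_resolution_of_chain` — (any locally Noetherian ambient `P`, integral `H`, closed immersion `ι₀ : H ↪ P`) a chain over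
  `(P, range ι₀)` with regular reduced end `Z = V(closure S') ⊆ P'` gives a resolution of singularities `ρ : Z → H` TOGETHER WITH
  its closed immersion `j : Z ↪ P'` and the square `ρ ≫ ι₀ = j ≫ σ` (the argument of `hasResolution_of_chain`, p165577 /
  `Theorems.EquisingularLift.Strength`, with the structure exposed instead of hidden behind `HasResolution`);
* `isProjectiveOver_of_chain` — along a chain over `ℙⁿ_k` every ambient stays projective over `k` (blow-ups of projective
  schemes are projective, Hartshorne II 7.16 (c), DISCHARGED `IsBlowup.isProjectiveOver`);
* `isProjectiveOver_comp_of_isClosedImmersion` — a closed subscheme of a projective `k`-scheme is projective;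
* `exists_projectiveResolution_of_chain` / **`blowupModel_of_chain`** — for an integral closed `ι : H ↪ ℙⁿ_k` (any field `k`),
  a chain of blow-ups of `ℙⁿ_k` in regular centres off the generic point of `range ι` whose reduced last strict transform is
  regular yields a resolution of `H` with projective source, hence (Liu 2002 Thm. 8.1.24, DISCHARGED) a non-zero ideal sheaf on
  `H` all of whose blow-ups are regular.

So each leaf `stub_blowupModel_n` of the line follows from EMBEDDED resolution of integral hypersurfaces of `ℙⁿ_k̄` in the crux's
chain format read over `k` (no `O`, no horizontality) — the format in which CJS (surfaces in threefolds) and the large-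
characteristic descent door (`DescDoorSharp`, rung LC) deliver. Honest label: plumbing between currencies; `--supports
stmt-ResolutionOfSingularities-15660 --as helper`, DEF-FREE, standard axioms, zero named hypotheses.

References: [Liu2002, Thm. 8.1.24]; [Hartshorne1977, II Prop. 7.16 (c), II.7.17]; [GortzWedhorn2020, Prop. 13.91, 13.96];
[StacksProject, Tags 02NS, 02OS].
-/

set_option linter.dupNamespace false -- mandated namespace `Summit.<Summit>.<Problem>` of this single-conjunct summit

noncomputable section

open CategoryTheory CategoryTheory.Limits AlgebraicGeometry TopologicalSpace Topology
open Literature.AlgebraicGeometry.Resolution Literature.AlgebraicGeometry.Motives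
open AlgebraicGeometry.Scheme.IdealSheafData
open Summit.ResolutionOfSingularities.ResolutionOfSingularities.Theses.EquisingularLift.Split

universe u

namespace Summit.ResolutionOfSingularities.ResolutionOfSingularities.Cruxes.EquisingularLift.StrataSplit

/-! ## The reduced last strict transform of a chain resolves, with its embedding exposed -/

/-- **The reduced iterated strict transform resolves — structured form.** Let `H` be integral, `ι₀ : H ⟶ P` a closed immersion
into a locally Noetherian scheme, and `(P', σ, S')` reached from `(P, 𝟙, range ι₀)` by a `Split.Chain` (finitely many blow-ups
in regular centres whose images avoid the generic point of `range ι₀`, `S'` the iterated strict transform). If the reduced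
closed subscheme `Z` on `closure S'` is regular, then the closed immersion `j : Z ↪ P'` followed by `σ` factors through `ι₀` as
a morphism `ρ : Z → H` (`ρ ≫ ι₀ = j ≫ σ`) which is a resolution of singularities of `H` (proper, birational — `σ` is proper
and an isomorphism over an open containing the generic point, `S' = closure {ξ'}` — with regular source). The argument of
`Theorems.EquisingularLift.hasResolution_of_chain`, with the witnesses exposed. [folklore]
[cite: GortzWedhorn2020, Prop. 13.91 (3)] [cite: StacksProject, Tag 02NS] -/
theorem exists_resolution_of_chain (P P' H : Scheme.{0}) [IsLocallyNoetherian P] [IsIntegral H] (ι₀ : H ⟶ P)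
    [IsClosedImmersion ι₀] (σ : P' ⟶ P) (S' : Set P') (hch : Chain P (Set.range ι₀) P' σ S')
    (hreg : Scheme.IsRegular (vanishingIdeal (⟨closure S', isClosed_closure⟩ : Closeds P')).subscheme) :
    ∃ ρ : (vanishingIdeal (⟨closure S', isClosed_closure⟩ : Closeds P')).subscheme ⟶ H,
      ρ ≫ ι₀ = (vanishingIdeal (⟨closure S', isClosed_closure⟩ : Closeds P')).subschemeι ≫ σ ∧ IsResolution ρ := by
  classical
  have hYcl : IsClosed (Set.range ι₀) := ι₀.isClosedEmbedding.isClosed_range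
  have hgen : IsGenericPoint (ι₀ (genericPoint H)) (Set.range ι₀) := by
    have h := (genericPoint_spec H).image ι₀.continuous
    rwa [Set.image_univ, hYcl.closure_eq] at h
  set ξ : P := ι₀ (genericPoint H) with hξdef
  have hYξ : Set.range ι₀ = closure {ξ} := hgen.symm
  have hT : ξ ∉ {x : P | ¬ IsGenericPoint x (Set.range ι₀)} := by
    simp only [Set.mem_setOf_eq, not_not]
    exact hgen
  have hstruct : IsProper σ ∧ ∃ V : P.Opens,
      {x : P | ¬ IsGenericPoint x (Set.range ι₀)}ᶜ ⊆ (V : Set P) ∧ IsIso (σ ∣_ V) ∧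
        ∃ ξ' : P', σ ξ' = ξ ∧ S' = closure {ξ'} := by
    refine hch (fun X' σ' Y' => IsProper σ' ∧ ∃ V : P.Opens,
      {x : P | ¬ IsGenericPoint x (Set.range ι₀)}ᶜ ⊆ (V : Set P) ∧ IsIso (σ' ∣_ V) ∧
        ∃ ξ' : X', σ' ξ' = ξ ∧ Y' = closure {ξ'}) ?_ ?_
    · -- no blow-up
      refine ⟨inferInstance, ⊤, by simp, ?_, ξ, rfl, hYξ⟩
      infer_instance
    · -- one more blow-up `τ : X'' ⟶ X'` along `C`, regular centre whose image avoids `ξ`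
      intro X' X'' σ' Y' C τ hQ hτ _ hTC
      obtain ⟨hσ', V, hTV, hiso, ξ', hξ', hY'⟩ := hQ
      haveI := hσ'
      haveI : IsLocallyNoetherian X' := LocallyOfFiniteType.isLocallyNoetherian σ'
      haveI : IsProper τ := hτ.isProper
      have hclosed : IsClosed (σ' '' (C.support : Set X')) :=
        σ'.isClosedMap _ C.support.isClosed
      let V' : P.Opens := V ⊓ ⟨(σ' '' (C.support : Set X'))ᶜ, hclosed.isOpen_compl⟩
      have hV'V : V' ≤ V := inf_le_left
      have hTV' : {x : P | ¬ IsGenericPoint x (Set.range ι₀)}ᶜ ⊆ (V' : Set P) :=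
        fun x hx => ⟨hTV hx, fun hx' => hx (hTC hx')⟩
      let Wc : X'.Opens := ⟨(C.support : Set X')ᶜ, C.support.isClosed.isOpen_compl⟩
      have hWc : IsIso (τ ∣_ Wc) := hτ.isIso_morphismRestrict disjoint_compl_left
      have hle : (Opens.map σ'.base).obj V' ≤ Wc := fun x hx hxC => hx.2 ⟨x, hxC, rfl⟩
      have hiso' : IsIso ((CategoryStruct.comp τ σ') ∣_ V') := by
        rw [morphismRestrict_comp]
        have i1 := isIso_morphismRestrict_of_le σ' hiso hV'V
        have i2 := isIso_morphismRestrict_of_le τ hWc hle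
        exact @IsIso.comp_isIso _ _ _ _ _ _ _ i2 i1
      have hξ'C : ξ' ∉ (C.support : Set X') := fun h' => hT (hTC ⟨ξ', h', hξ'⟩)
      obtain ⟨ξ₂, hξ₂, huniq⟩ := existsUnique_preimage τ hWc (y := ξ') hξ'C
      have hfib : τ ⁻¹' {ξ'} = {ξ₂} := by
        ext z
        simp only [Set.mem_preimage, Set.mem_singleton_iff]
        exact ⟨fun hz => huniq z hz, fun hz => hz ▸ hξ₂⟩
      refine ⟨inferInstance, V', hTV', hiso', ξ₂,
        by rw [Scheme.Hom.comp_apply, hξ₂, hξ'], ?_⟩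
      apply le_antisymm
      · refine closure_minimal ?_ isClosed_closure
        rintro x ⟨hxY, hxC⟩
        rw [hY'] at hxY
        have hx := preimage_closure_inter_subset τ hWc {ξ'} ⟨hxY, hxC⟩
        rwa [hfib] at hx
      · refine closure_mono (Set.singleton_subset_iff.mpr ?_)
        refine ⟨?_, ?_⟩
        · rw [hY']
          show τ ξ₂ ∈ closure {ξ'}
          rw [hξ₂]
          exact subset_closure rfl
        · show τ ξ₂ ∉ (C.support : Set X')
          rw [hξ₂]
          exact hξ'C
  obtain ⟨hσ, V, hTV, hiso, ξ', hξ', hY'⟩ := hstruct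
  haveI := hσ
  set Z : Closeds P' := ⟨closure S', isClosed_closure⟩ with hZdef
  have hZ : (Z : Set P') = closure {ξ'} := by
    change closure S' = closure {ξ'}
    rw [hY', closure_closure]
  let j := (vanishingIdeal Z).subschemeι
  haveI : IsIntegral (vanishingIdeal Z).subscheme :=
    ComponentGluing.isIntegral_subscheme_vanishingIdeal Z (hZ ▸ isIrreducible_singleton.closure)
  have hrangej : Set.range j = closure {ξ'} := by
    rw [range_subschemeι, Scheme.IdealSheafData.coe_support_vanishingIdeal, hZ]
  have hker : ι₀.ker ≤ (CategoryStruct.comp j σ).ker := by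
    have e1 : (CategoryStruct.comp j σ).ker = vanishingIdeal (.closure (σ '' (Z : Set P'))) := by
      rw [← map_vanishingIdeal]
      rfl
    rw [e1, ← le_support_iff_le_vanishingIdeal]
    have e2 : (ι₀.ker.support : Set P) = Set.range ι₀ := by
      rw [Scheme.Hom.support_ker, hYcl.closure_eq]
    rw [← SetLike.coe_subset_coe, e2, Closeds.closure]
    change closure (σ '' (Z : Set P')) ⊆ Set.range ι₀
    rw [hYξ, hZ]
    refine closure_minimal ((image_closure_subset_closure_image σ.continuous).trans ?_)
      isClosed_closure
    rw [Set.image_singleton, hξ']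
  let ρ : (vanishingIdeal Z).subscheme ⟶ H := IsClosedImmersion.lift ι₀ (CategoryStruct.comp j σ) hker
  have hρ : CategoryStruct.comp ρ ι₀ = CategoryStruct.comp j σ :=
    IsClosedImmersion.lift_fac ι₀ (CategoryStruct.comp j σ) hker
  have hρapp : ∀ y, ι₀ (ρ y) = σ (j y) := fun y => by
    rw [← Scheme.Hom.comp_apply, hρ, Scheme.Hom.comp_apply]
  haveI : IsProper ρ := by
    have hc : IsProper (CategoryStruct.comp ρ ι₀) := by rw [hρ]; infer_instance
    exact MorphismProperty.of_postcomp (W := @AlgebraicGeometry.IsProper)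
      (W' := @AlgebraicGeometry.IsSeparated) ρ ι₀ inferInstance hc
  let U : H.Opens := (Opens.map ι₀.base).obj V
  have hξV : ξ ∈ V := hTV hT
  have hηU : genericPoint H ∈ U := hξV
  obtain ⟨y₀, hy₀⟩ : ξ' ∈ Set.range j := by
    rw [hrangej]
    exact subset_closure rfl
  have hfibξ : σ ⁻¹' {ξ} = {ξ'} := by
    obtain ⟨x, -, huniq⟩ := existsUnique_preimage σ hiso hξV
    ext z
    simp only [Set.mem_preimage, Set.mem_singleton_iff]
    exact ⟨fun hz => (huniq z hz).trans (huniq ξ' hξ').symm, fun hz => hz ▸ hξ'⟩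
  have hover : ∀ x : P', σ x ∈ Set.range ι₀ → σ x ∈ V → x ∈ closure {ξ'} := by
    intro x hx hxV
    rw [hYξ] at hx
    have hx' := preimage_closure_inter_subset σ hiso {ξ} ⟨hx, hxV⟩
    rwa [hfibξ] at hx'
  have hbir : IsBirational ρ := by
    refine ⟨U, ?_, ?_, ?_⟩
    · have hd : Dense ({genericPoint H} : Set H) := by
        rw [dense_iff_closure_eq]
        exact genericPoint_spec H
      exact hd.mono (Set.singleton_subset_iff.mpr hηU)
    · have hgen' : closure ({y₀} : Set (vanishingIdeal Z).subscheme) = Set.univ := by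
        rw [j.isClosedEmbedding.isInducing.closure_eq_preimage_closure_image,
          Set.image_singleton, hy₀, ← hrangej, Set.preimage_range]
      have hd : Dense ({y₀} : Set (vanishingIdeal Z).subscheme) := by
        rw [dense_iff_closure_eq]
        exact hgen'
      refine hd.mono (Set.singleton_subset_iff.mpr ?_)
      change ι₀ (ρ y₀) ∈ V
      rw [hρapp, hy₀, hξ']
      exact hξV
    · haveI : IsClosedImmersion (ρ ∣_ U) := by
        have i1 : IsClosedImmersion ((CategoryStruct.comp j σ) ∣_ V) := by
          rw [morphismRestrict_comp]
          haveI := hiso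
          exact (MorphismProperty.cancel_right_of_respectsIso
            @AlgebraicGeometry.IsClosedImmersion _ _).mpr
            (IsZariskiLocalAtTarget.restrict (inferInstanceAs (IsClosedImmersion j)) _)
        rw [← hρ, morphismRestrict_comp] at i1
        exact MorphismProperty.of_postcomp (W := @AlgebraicGeometry.IsClosedImmersion)
          (W' := @AlgebraicGeometry.IsSeparated) (ρ ∣_ U) (ι₀ ∣_ V) inferInstance i1
      haveI : AlgebraicGeometry.Surjective (ρ ∣_ U) := by
        refine ⟨fun u => ?_⟩
        have hu : ι₀ u.1 ∈ V := u.2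
        obtain ⟨x, hx, -⟩ := existsUnique_preimage σ hiso hu
        have hxZ : x ∈ Set.range j := by
          rw [hrangej]
          exact hover x (hx ▸ Set.mem_range_self _) (hx ▸ hu)
        obtain ⟨y₁, rfl⟩ := hxZ
        have hρy₁ : ρ y₁ = u.1 := ι₀.isClosedEmbedding.injective (by rw [hρapp, hx])
        refine ⟨⟨y₁, show ρ y₁ ∈ U by rw [hρy₁]; exact u.2⟩, Subtype.ext ?_⟩
        rw [morphismRestrict_base_coe]
        exact hρy₁
      exact isIso_of_isClosedImmersion_of_surjective _
  exact ⟨ρ, hρ, ⟨inferInstance, hbir, hreg⟩⟩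

/-! ## Projectivity along a chain over `ℙⁿ_k` -/

/-- **A closed subscheme of a projective `k`-scheme is projective over `k`**: if `X → Spec k` admits a closed `k`-immersion
into some `ℙᴺ_k` and `j : Z ↪ X` is a closed immersion, so does `Z` with the structure morphism `j ≫ (X → Spec k)`.
[cite: Hartshorne1977, II Ex. 4.9 context, Def. before II.4.9] -/
theorem isProjectiveOver_comp_of_isClosedImmersion {k : Type u} [Field k] {Z X : Scheme.{u}} (j : Z ⟶ X)
    [IsClosedImmersion j] (f : X ⟶ Spec (.of k)) (h : IsProjectiveOver (Over.mk f)) :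
    IsProjectiveOver (Over.mk (j ≫ f)) := by
  obtain ⟨N, e, he⟩ := h
  -- the closed immersion `X ↪ ℙᴺ_k`, retyped with source `X`
  let e' : X ⟶ (projectiveSpace N k).left := e.left
  haveI : IsClosedImmersion e' := he
  have hw : e' ≫ (projectiveSpace N k).hom = f := Over.w e
  refine ⟨N, Over.homMk (j ≫ e') ?_, ?_⟩
  · change (j ≫ e') ≫ (projectiveSpace N k).hom = j ≫ f
    rw [Category.assoc, hw]
  · change IsClosedImmersion (j ≫ e')
    infer_instance

/-- **Along a chain over `ℙⁿ_k` the ambient stays projective over `k`**: every blow-up of a projective `k`-scheme is projective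
over `k` (Hartshorne II, Prop. 7.16 (c), DISCHARGED in the tree as `IsBlowup.isProjectiveOver`), by induction along the chain.
[cite: Hartshorne1977, II Prop. 7.16 (c)] -/
theorem isProjectiveOver_of_chain {k : Type} [Field k] {n : ℕ} {Y : Set ↥(projectiveSpace n k).left} {P' : Scheme.{0}}
    {σ : P' ⟶ (projectiveSpace n k).left} {S' : Set P'} (hch : Chain (projectiveSpace n k).left Y P' σ S') :
    IsProjectiveOver (Over.mk (σ ≫ (projectiveSpace n k).hom)) := by
  refine hch (fun X' σ' _ => IsProjectiveOver (Over.mk (σ' ≫ (projectiveSpace n k).hom))) ?_ ?_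
  · -- no blow-up: `ℙⁿ_k` itself
    let e₀ : (projectiveSpace n k).left ⟶ (projectiveSpace n k).left := 𝟙 _
    have hw : e₀ ≫ (projectiveSpace n k).hom = 𝟙 _ ≫ (projectiveSpace n k).hom := rfl
    refine ⟨n, Over.homMk e₀ hw, ?_⟩
    change IsClosedImmersion (𝟙 _)
    infer_instance
  · -- one more blow-up
    intro X' X'' σ' Y' C τ hQ hτ _ _
    have h := hτ.isProjectiveOver (σ' ≫ (projectiveSpace n k).hom) hQ
    rwa [← Category.assoc] at h

/-! ## From a chain over `ℙⁿ_k` to a projective resolution and a regular blow-up model -/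

/-- **A chain over `ℙⁿ_k` with regular reduced end gives a resolution with PROJECTIVE source**: for a field `k`, an integral
closed `ι : H ↪ ℙⁿ_k` and `(P', σ, S')` reached from `(ℙⁿ_k, 𝟙, range ι)` by blow-ups in regular centres off the generic point
with `V(closure S')_red` regular, the morphism `ρ : V(closure S')_red → H` of `exists_resolution_of_chain` is a resolution of
singularities whose source is projective over `k` (closed in the projective `P'`). [cite: Hartshorne1977, II Prop. 7.16 (c)]
[cite: GortzWedhorn2020, Prop. 13.91 (3)] -/
theorem exists_projectiveResolution_of_chain {k : Type} [Field k] {n : ℕ} {H : Scheme.{0}} [IsIntegral H]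
    (ι : H ⟶ (projectiveSpace n k).left) [IsClosedImmersion ι] {P' : Scheme.{0}}
    (σ : P' ⟶ (projectiveSpace n k).left) (S' : Set P') (hch : Chain (projectiveSpace n k).left (Set.range ι) P' σ S')
    (hreg : Scheme.IsRegular (vanishingIdeal (⟨closure S', isClosed_closure⟩ : Closeds P')).subscheme) :
    ∃ (Z : Scheme.{0}) (π : Z ⟶ H), IsResolution π ∧
      IsProjectiveOver (Over.mk (π ≫ ι ≫ (projectiveSpace n k).hom)) := by
  haveI : IsProper (projectiveSpace n k).hom := isProper_projectiveSpace n k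
  haveI : IsLocallyNoetherian (projectiveSpace n k).left :=
    LocallyOfFiniteType.isLocallyNoetherian (projectiveSpace n k).hom
  obtain ⟨ρ, hρ, hres⟩ := exists_resolution_of_chain _ P' H ι σ S' hch hreg
  refine ⟨_, ρ, hres, ?_⟩
  have hZ := isProjectiveOver_comp_of_isClosedImmersion
    (vanishingIdeal (⟨closure S', isClosed_closure⟩ : Closeds P')).subschemeι (σ ≫ (projectiveSpace n k).hom)
    (isProjectiveOver_of_chain hch)
  rw [← Category.assoc, hρ, Category.assoc]
  exact hZ

/-- **THE DOWNSTAIRS READING: a chain over `ℙⁿ_k` with regular reduced end gives a regular blow-up model.** For a field `k`,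
an integral closed `ι : H ↪ ℙⁿ_k` and `(P', σ, S')` reached from `(ℙⁿ_k, 𝟙, range ι)` by blow-ups in regular centres off the
generic point of `range ι` (`Split.Chain`, the crux's own chain format, over `k`) such that the reduced closed subscheme on
`closure S'` is regular, there is a non-zero ideal sheaf on `H` ALL of whose blow-ups are regular (projective resolution
`exists_projectiveResolution_of_chain` + Liu 2002 Thm. 8.1.24, DISCHARGED, `blowupModel_of_projectiveResolution`).
[cite: Liu2002, Thm. 8.1.24] [cite: Hartshorne1977, II.7.17, II Prop. 7.16 (c)] -/
theorem blowupModel_of_chain {k : Type} [Field k] {n : ℕ} {H : Scheme.{0}} [IsIntegral H]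
    (ι : H ⟶ (projectiveSpace n k).left) [IsClosedImmersion ι] {P' : Scheme.{0}}
    (σ : P' ⟶ (projectiveSpace n k).left) (S' : Set P') (hch : Chain (projectiveSpace n k).left (Set.range ι) P' σ S')
    (hreg : Scheme.IsRegular (vanishingIdeal (⟨closure S', isClosed_closure⟩ : Closeds P')).subscheme) :
    ∃ 𝔞 : H.IdealSheafData, 𝔞 ≠ ⊥ ∧ ∀ (Z : Scheme.{0}) (π : Z ⟶ H), IsBlowup π 𝔞 → Scheme.IsRegular Z :=
  blowupModel_of_projectiveResolution ι (exists_projectiveResolution_of_chain ι σ S' hch hreg)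

/-- **`HasResolution` form** (projectivity forgotten): the same data give `Scheme.HasResolution H` — for any locally
Noetherian ambient this is `Theorems.EquisingularLift.hasResolution_of_chain`; recorded here next to its projective
refinement. [cite: StacksProject, Tag 02NS] -/
theorem hasResolution_of_chain_projectiveSpace {k : Type} [Field k] {n : ℕ} {H : Scheme.{0}} [IsIntegral H]
    (ι : H ⟶ (projectiveSpace n k).left) [IsClosedImmersion ι] {P' : Scheme.{0}}
    (σ : P' ⟶ (projectiveSpace n k).left) (S' : Set P') (hch : Chain (projectiveSpace n k).left (Set.range ι) P' σ S')
    (hreg : Scheme.IsRegular (vanishingIdeal (⟨closure S', isClosed_closure⟩ : Closeds P')).subscheme) :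
    Scheme.HasResolution H := by
  obtain ⟨Z, π, hres, -⟩ := exists_projectiveResolution_of_chain ι σ S' hch hreg
  exact ⟨Z, π, hres⟩

end Summit.ResolutionOfSingularities.ResolutionOfSingularities.Cruxes.EquisingularLift.StrataSplit

end
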